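import Summits.BirchSwinnertonDyer.BirchSwinnertonDyer.Theses.TameQuarticManinParity
import Summits.BirchSwinnertonDyer.Rank1Residual.O5.CharTwistThreeIsometry
import HarnessLib

/-!
# Route `TameQuarticManinParity`, G47 (LINE 47 glue): `(∀ N, newSubspace0_eq_orthogonal N 2) → CuspRegularResidueLaw → StrictRegularTracesGenerate` — glue item stmt-BirchSwinnertonDyer-24752 `StrictTracesGenerateOfResidueLaw`, BY NAME

Verbatim landing (leaf hand `leafhand-bsd-tamequarticmaninpa-1-g0`, cone of the cruxes 23736/23737, announced on the
bsd-eis STATUS before proposing) of the planner-of-record's kernel-checked glue, HOME `ideators/bsd-idea-3/ideas/l47/Sketch47.lean sha16 f624cdf9cacde3ae (bsd-idea-3 g13, 2026-08-29T14:19Z)`;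
there the route items were shadow `def`s (pre-render), here the theorem is stated against the rendered route decls
(route rev 87) — the proof script is the pen's, unchanged unless noted.  Glue only: the children and every crux above
stay OPEN; no summit is proved; BSD is NOT proved; Manin's conjecture is not proved.
-/

set_option autoImplicit false
-- D-0017: single-problem summit, so `Summit.BirchSwinnertonDyer.BirchSwinnertonDyer.…` repeats a namespace BY DESIGN.
set_option linter.dupNamespace false
open Summit.BirchSwinnertonDyer.BirchSwinnertonDyer.Theses.TameQuarticManinParity
open Literature.NumberTheory.EllipticCurves.ModularForms CongruenceSubgroup
open Summit.BirchSwinnertonDyer.Rank1Residual.O5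
open scoped MatrixGroups ModularForm

namespace Summit.BirchSwinnertonDyer.BirchSwinnertonDyer.Theorems.TameQuarticManinParity

/-- **LINE 47 glue.** Write a cusp-regular rational `g` as `b₁ + R h` with `b₁` strict and `h` old (RL47).
Then `⟨f, R h⟩ = ⟨R(Rf), R h⟩ = ⟨Rf, h⟩ = 0` (twist isometry on the depleted form `Rf`, `R(Rf) = f`, and
`Rf` new ⟂ `h` old by Atkin–Lehner–Li), so `⟨f, g⟩ = ⟨f, b₁⟩` and the strict hypothesis gives the trace. -/
theorem strictTracesGenerate_of_residueLaw : StrictTracesGenerateOfResidueLaw := by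
  intro hOrth hRL N _ hv2 h9 χ hχ hprim f hnew hnewR hfq hdep c hH g hgq hgreg
  obtain ⟨b₁, h, hold, hb₁q, hb₁reg, hb₁str, hgb⟩ := hRL N hv2 h9 χ hχ hprim g hgq hgreg
  obtain ⟨t, ht0, ht⟩ := hH b₁ hb₁q hb₁reg hb₁str
  have hdepR : ∀ n : ℕ, 3 ∣ n → cuspCoeff (charTwist N (dvd_refl _) h9 hχ f) n = 0 :=
    fun n hn ↦ cuspCoeff_charTwist_eq_zero_of_dvd h9 hχ hprim f hn
  have hRR : charTwist N (dvd_refl _) h9 hχ (charTwist N (dvd_refl _) h9 hχ f) = f :=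
    charTwist_charTwist h9 hχ hprim hdep
  have hmem := (Set.ext_iff.mp (hOrth N) (charTwist N (dvd_refl _) h9 hχ f)).mp hnewR.1
  simp only [Set.mem_setOf_eq] at hmem
  have hperp : peterssonProduct (Gamma0 N) 2 f (charTwist N (dvd_refl _) h9 hχ h) = 0 :=
    calc peterssonProduct (Gamma0 N) 2 f (charTwist N (dvd_refl _) h9 hχ h)
        = peterssonProduct (Gamma0 N) 2 (charTwist N (dvd_refl _) h9 hχ (charTwist N (dvd_refl _) h9 hχ f))
            (charTwist N (dvd_refl _) h9 hχ h) := by rw [hRR]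
      _ = peterssonProduct (Gamma0 N) 2 (charTwist N (dvd_refl _) h9 hχ f) h :=
            peterssonProduct_charTwist_charTwist h9 hχ hprim hdepR h
      _ = 0 := hmem h hold
  refine ⟨t, ht0, ?_⟩
  rw [hgb, peterssonProduct_add_right, ht, hperp, add_zero]

end Summit.BirchSwinnertonDyer.BirchSwinnertonDyer.Theorems.TameQuarticManinParity
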